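import Summits.KontsevichZagierPeriods.KontsevichZagierPeriods.Theses.FurushoPentagon
import Summits.KontsevichZagierPeriods.KontsevichZagierPeriods.Theorems.FurushoPentagonReducedPeriodRingDefs
import Literature.NumberTheory.Transcendental.KZCubicalCalculus
import Literature.NumberTheory.Transcendental.KZLogCalculusProofs
import Literature.NumberTheory.Transcendental.KZSemiCanonicalReductionDimOne
import Literature.NumberTheory.Transcendental.KZBallPeelingAux
import Literature.NumberTheory.Transcendental.KZIntervalPeriodProofs
import Literature.NumberTheory.Transcendental.SemialgebraicMapsProofs
import Literature.ModelTheory.ExponentialFields.SemialgebraicC1TriangulationProofs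

/-!
# `SectorToKernel`, line `effective-cube-surjection`, dimension-one rung: an analytic piece resolves (R6)

Stub `stub_analyticPieceResolves` of the crux `FurushoPentagon.SectorToKernel`
(stmt-KontsevichZagierPeriods-10813), granted its three quoted antecedents R1 (real Puiseux normal
form to the right of a point), R3 (tameness at `0` after the power substitution) and R4 (one
normalised piece is a tame cube class). A representation `u = [(0,1), f]` whose integrand is
analytic on the OPEN interval (possibly singular at both endpoints) is, modulo the KZ relations, a
`ℤ`-combination of tame cube classes:

* split `(0,1) = (0,½) ∪ (½,1)` at the null point `½` (rule (1), `apiece_split`);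
* move each half onto `(0,1)` with its possibly singular endpoint at `0` by the affine rule-(2)
  moves `s = x/2`, `s = 1 - x/2` (rational coefficients, Jacobian `½`; `apiece_exists_affine`, an
  instance of `KZ.changeOfVariablesRel` in `ℝ¹`, integrability by the Jacobian formula);
* the rescaled integrands `g` are analytic on `(0, 1]`, integrable, and satisfy a non-trivial
  polynomial relation `P(s, g s) = 0` (they are `ℚ`-semialgebraic; Basu–Pollack–Roy, Prop. 2.86,
  `exists_mvPolynomial_ne_zero_eval_graph_eq_zero`), so R1 gives the Puiseux normal form at `0⁺`,
  R3 the analytic extension of `t ↦ g(tᵉ) · e tᵉ⁻¹` to `[0, 1]`, and R4 the tame cube class;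
* the two classes are added.

References: M. Kontsevich, D. Zagier, *Periods* (2001), §1.2, rules (1), (2); S. Basu,
R. Pollack, M.-F. Roy, *Algorithms in Real Algebraic Geometry* (2006), Prop. 2.86.
-/

noncomputable section

namespace Summit.KontsevichZagierPeriods.FurushoPentagon.SectorToKernel

open Set MeasureTheory
open Literature.NumberTheory.Transcendental
open Literature.NumberTheory.Transcendental.KZ hiding cubicalSpan
open Summit.KontsevichZagierPeriods.KontsevichZagierPeriods.Theses.FurushoPentagon
open Summit.KontsevichZagierPeriods.FurushoPentagon.ReducedPeriodRing (unitCube cubicalGens cubicalSpan)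
open Literature.ModelTheory.ExponentialFields (IsSemialgebraic)

/-! ### Reading a one-dimensional representation on the real line -/

/-- The integrand of a representation on `{x : ℝ¹ | x 0 ∈ S}`, read on the line, is integrable on
`S` (`ℝ¹ ≃ᵐ ℝ` is volume preserving). [folklore] -/
theorem apiece_integrableOn_line (v : IntegralRep 1) {S : Set ℝ}
    (hv : v.domain = {x : Fin 1 → ℝ | x 0 ∈ S}) :
    IntegrableOn (fun s : ℝ => v.integrand (fun _ => s)) S := by
  set Φ := MeasurableEquiv.funUnique (Fin 1) ℝ with hΦ
  have hΦe : ⇑Φ.symm = fun (t : ℝ) (_ : Fin 1) => t := by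
    funext t i
    rw [hΦ, MeasurableEquiv.funUnique_symm_apply]
    exact uniqueElim_const t i
  have h := ((volume_preserving_funUnique (Fin 1) ℝ).symm Φ).integrableOn_comp_preimage
    Φ.symm.measurableEmbedding (f := v.integrand) (s := v.domain)
  rw [hΦe] at h
  have hS : (fun (t : ℝ) (_ : Fin 1) => t) ⁻¹' {x : Fin 1 → ℝ | x 0 ∈ S} = S := by
    ext t
    simp
  have h' := h.mpr v.integrableOn
  rw [hv, hS] at h'
  exact h'

/-- The integrand of a representation on `{x : ℝ¹ | x 0 ∈ S}`, read on the line, satisfies a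
non-trivial real polynomial relation `P(s, f s) = 0` on `S`: its graph over `S` is a real
semialgebraic subset of `ℝ²` with empty interior. [Basu–Pollack–Roy 2006, Prop. 2.86] -/
theorem apiece_exists_mvPolynomial (v : IntegralRep 1) {S : Set ℝ}
    (hv : v.domain = {x : Fin 1 → ℝ | x 0 ∈ S}) :
    ∃ P : MvPolynomial (Fin 2) ℝ, P ≠ 0 ∧
      ∀ s ∈ S, MvPolynomial.eval ![s, v.integrand (fun _ => s)] P = 0 := by
  have hsa : IsSemialgebraicFunOn ℚ {t : Fin 1 → ℝ | t 0 ∈ S}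
      (fun t => v.integrand (fun _ => t 0)) := by
    have h := v.isSemialgebraicFunOn_integrand
    rw [hv] at h
    exact h.congr fun t _ => congrArg v.integrand (eq_const_apply_zero t)
  have hG :=
    Literature.ModelTheory.ExponentialFields.isSemialgebraic_graph_of_isSemialgebraicFunOn
      (f := fun s : ℝ => v.integrand (fun _ => s)) hsa
  obtain ⟨P, hP0, hP⟩ :=
    Literature.ModelTheory.ExponentialFields.exists_mvPolynomial_ne_zero_eval_graph_eq_zero
      (S := S) (f := fun s : ℝ => v.integrand (fun _ => s)) Fin.zero_ne_one hG
  exact ⟨P, hP0, fun s hs => hP _ (by simpa using hs) (by simp)⟩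

/-! ### Affine rule-(2) moves in dimension one -/

/-- **Affine change of variables in `ℝ¹` with rational coefficients.** For `r'` a representation,
`α, β ∈ ℚ` (real values `a`, `b ≠ 0`) and a `ℚ`-semialgebraic `D ⊆ ℝ¹` with
`r'.domain = {a + b x | x ∈ D}`, the representation `[D, x ↦ r'.integrand (a + b x) · |b|]` exists
(semialgebraic by composition with a polynomial map, integrable by the Jacobian formula) and differs
from `[r']` by ONE instance of Kontsevich–Zagier's rule (2) along `Φ x = a + b x` (`|det Φ'| = |b|`).
[Kontsevich–Zagier 2001, §1.2, rule (2)] -/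
theorem apiece_exists_affine (r' : IntegralRep 1) (α β : ℚ) {a b : ℝ} (ha : (α : ℝ) = a)
    (hb : (β : ℝ) = b) (hb0 : b ≠ 0) {D : Set (Fin 1 → ℝ)} (hD : IsSemialgebraic ℚ D)
    (hd : ∀ y : Fin 1 → ℝ, y ∈ r'.domain ↔ (fun _ : Fin 1 => (y 0 - a) / b) ∈ D) :
    ∃ r : IntegralRep 1, r.domain = D ∧
      (r.integrand = fun x => r'.integrand (fun _ => a + b * x 0) * |b|) ∧
      of r - of r' ∈ relations := by
  set Φ : (Fin 1 → ℝ) → (Fin 1 → ℝ) := fun x _ => a + b * x 0 with hΦ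
  set L : (Fin 1 → ℝ) →L[ℝ] (Fin 1 → ℝ) := b • ContinuousLinearMap.id ℝ (Fin 1 → ℝ) with hL
  -- derivative, determinant, injectivity, image
  have hΦeq : Φ = fun x => (fun _ : Fin 1 => a) + b • x := by
    funext x i
    rw [Fin.fin_one_eq_zero i]
    simp [hΦ]
  have hderiv : ∀ x, HasFDerivAt Φ L x := fun x => by
    rw [hΦeq]
    exact ((hasFDerivAt_id x).const_smul b).const_add _
  have hdet : L.det = b := by
    have h : ((L : (Fin 1 → ℝ) →L[ℝ] (Fin 1 → ℝ)) : (Fin 1 → ℝ) →ₗ[ℝ] (Fin 1 → ℝ)) =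
        b • LinearMap.id := rfl
    change LinearMap.det ((L : (Fin 1 → ℝ) →L[ℝ] (Fin 1 → ℝ)) :
      (Fin 1 → ℝ) →ₗ[ℝ] (Fin 1 → ℝ)) = b
    rw [h, LinearMap.det_smul, LinearMap.det_id, Module.finrank_fin_fun, pow_one, mul_one]
  have hinj : InjOn Φ D := fun x _ y _ h => by
    have h0 : a + b * x 0 = a + b * y 0 := congrFun h 0
    funext i
    rw [Fin.fin_one_eq_zero i]
    exact mul_left_cancel₀ hb0 (add_left_cancel h0)
  have himage : r'.domain = Φ '' D := by
    ext y
    rw [hd, mem_image]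
    constructor
    · intro hy
      refine ⟨_, hy, funext fun i => ?_⟩
      rw [Fin.fin_one_eq_zero i]
      show a + b * ((y 0 - a) / b) = y 0
      rw [mul_div_cancel₀ _ hb0, add_sub_cancel]
    · rintro ⟨x, hx, rfl⟩
      have hx' : (fun _ : Fin 1 => (Φ x 0 - a) / b) = x := by
        funext i
        rw [Fin.fin_one_eq_zero i]
        show (a + b * x 0 - a) / b = x 0
        rw [add_sub_cancel_left, mul_div_cancel_left₀ _ hb0]
      rw [hx']
      exact hx
  -- semialgebraicity of the substitution and of the pulled-back integrand
  have hΦsa : IsSemialgebraicMapOn ℚ D Φ :=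
    (isSemialgebraicMapOn_aeval hD (fun _ : Fin 1 =>
      (MvPolynomial.C α + MvPolynomial.C β * MvPolynomial.X 0 : MvPolynomial (Fin 1) ℚ))).congr
      fun x _ => by
        funext j
        simp only [hΦ, map_add, map_mul, MvPolynomial.aeval_C, MvPolynomial.aeval_X, eq_ratCast,
          ha, hb]
  have hsa : IsSemialgebraicFunOn ℚ D (fun x => r'.integrand (Φ x) * |b|) := by
    have h1 : IsSemialgebraicFunOn ℚ D (r'.integrand ∘ Φ) :=
      IsSemialgebraicFunOn.comp_isSemialgebraicMapOn_holds r'.isSemialgebraicFunOn_integrand hΦsa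
        fun x hx => by
          rw [himage]
          exact mem_image_of_mem Φ hx
    have h2 : IsSemialgebraicFunOn ℚ D (fun _ => |b|) :=
      (isSemialgebraicFunOn_ratCast hD |β|).congr fun x _ => by
        show ((|β| : ℚ) : ℝ) = |b|
        rw [Rat.cast_abs, hb]
    exact IsSemialgebraicFunOn.mul_holds h1 h2
  -- integrability of the pulled-back integrand (Jacobian formula)
  have hDm : MeasurableSet D :=
    Literature.ModelTheory.ExponentialFields.IsSemialgebraic.measurableSet_holds hD
  have hint : IntegrableOn (fun x => r'.integrand (Φ x) * |b|) D := by
    have h0 : IntegrableOn r'.integrand (Φ '' D) := by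
      rw [← himage]
      exact r'.integrableOn
    have h := (integrableOn_image_iff_integrableOn_abs_det_fderiv_smul volume hDm
      (fun x _ => (hderiv x).hasFDerivWithinAt) hinj r'.integrand).mp h0
    refine h.congr_fun (fun x _ => ?_) hDm
    show |L.det| • r'.integrand (Φ x) = r'.integrand (Φ x) * |b|
    rw [hdet, smul_eq_mul, mul_comm]
  refine ⟨⟨D, fun x => r'.integrand (Φ x) * |b|, hD, hsa, hint⟩, rfl, rfl, ?_⟩
  refine changeOfVariablesRel_subset_relations ⟨1, _, r', Φ, fun _ => L, hΦsa,
    fun x _ => (hderiv x).hasFDerivWithinAt, hinj, himage, fun x _ => ?_, rfl⟩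
  show r'.integrand (Φ x) * |b| = r'.integrand (Φ x) * |L.det|
  rw [hdet]

/-! ### Splitting `(0, 1)` at `½` -/

/-- **Rule (1) at the null point `½`.** A representation on `(0,1) ⊆ ℝ¹` splits, modulo the
relations, into its restrictions to `(0,½)` and `(½,1)` (the point `½` is Lebesgue-null, then
domain additivity). [Kontsevich–Zagier 2001, §1.2, rule (1)] -/
theorem apiece_split (u : IntegralRep 1)
    (hu : u.domain = {x : Fin 1 → ℝ | x 0 ∈ Set.Ioo (0:ℝ) 1}) :
    ∃ u₁ u₂ : IntegralRep 1, u₁.domain = {x : Fin 1 → ℝ | x 0 ∈ Set.Ioo (0:ℝ) (1 / 2)} ∧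
      u₁.integrand = u.integrand ∧ u₂.domain = {x : Fin 1 → ℝ | x 0 ∈ Set.Ioo (1 / 2 : ℝ) 1} ∧
      u₂.integrand = u.integrand ∧ of u - of u₁ - of u₂ ∈ relations := by
  have hI₁ : IsSemialgebraic ℚ {x : Fin 1 → ℝ | x 0 ∈ Set.Ioo (0:ℝ) (1 / 2)} := by
    simpa using BallPeeling.isSemialgebraic_Ioo₁ 0 (1 / 2)
  have hI₂ : IsSemialgebraic ℚ {x : Fin 1 → ℝ | x 0 ∈ Set.Ioo (1 / 2 : ℝ) 1} := by
    simpa using BallPeeling.isSemialgebraic_Ioo₁ (1 / 2) 1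
  have h₁ : {x : Fin 1 → ℝ | x 0 ∈ Set.Ioo (0:ℝ) (1 / 2)} ⊆ u.domain := by
    rw [hu]
    exact fun x hx => ⟨hx.1, hx.2.trans (by norm_num)⟩
  have h₂ : {x : Fin 1 → ℝ | x 0 ∈ Set.Ioo (1 / 2 : ℝ) 1} ⊆ u.domain := by
    rw [hu]
    exact fun x hx => ⟨lt_trans (by norm_num) hx.1, hx.2⟩
  have hU := hI₁.union hI₂
  have hUsub := union_subset h₁ h₂
  -- the null point `½`
  have e1 : of u - of (u.restrict _ hU hUsub) ∈ relations := by
    refine u.of_sub_of_restrict_mem_relations hU hUsub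
      (measure_mono_null (fun x hx => ?_) (BallPeeling.volume_setOf_apply_eq_const 1 0 (1 / 2)))
    rw [hu] at hx
    obtain ⟨⟨hl, hr⟩, h3⟩ := hx
    simp only [mem_union, mem_setOf_eq, mem_Ioo, not_or, not_and, not_lt] at h3
    show x 0 = 1 / 2
    rcases lt_trichotomy (x 0) (1 / 2) with h | h | h
    · exact absurd (h3.1 hl) (not_le.2 h)
    · exact h
    · exact absurd hr (not_lt.2 (h3.2 h))
  -- domain additivity
  have e2 : of (u.restrict _ hU hUsub) - of (u.restrict _ hI₁ h₁) - of (u.restrict _ hI₂ h₂) ∈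
      relations := by
    refine domainAddRel_subset_relations ⟨1, u.restrict _ hU hUsub, u.restrict _ hI₁ h₁,
      u.restrict _ hI₂ h₂, rfl, ?_, fun x _ => rfl, fun x _ => rfl, rfl⟩
    refine measure_mono_null (fun x hx => ?_) measure_empty
    simp only [IntegralRep.domain_restrict, mem_inter_iff, mem_setOf_eq, mem_Ioo] at hx
    linarith [hx.1.2, hx.2.1]
  refine ⟨u.restrict _ hI₁ h₁, u.restrict _ hI₂ h₂, rfl, rfl, rfl, rfl, ?_⟩
  have : of u - of (u.restrict _ hI₁ h₁) - of (u.restrict _ hI₂ h₂) =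
      (of u - of (u.restrict _ hU hUsub)) +
        (of (u.restrict _ hU hUsub) - of (u.restrict _ hI₁ h₁) - of (u.restrict _ hI₂ h₂)) := by
    abel
  rw [this]
  exact relations.add_mem e1 e2

/-! ### The stub -/

/-- **R6 (an analytic piece on `(0,1)` resolves), granted R1, R3, R4.** Split at `1/2`, rescale
both halves to `(0, 1)` with the possibly singular endpoint at `0` (affine rule-(2) moves with
rational coefficients), take the Puiseux normal form at `0⁺` (R1; the polynomial relation comes
from `ℚ`-semialgebraicity of the integrand), extend after the power substitution (R3) and conclude
with R4. [Kontsevich–Zagier 2001, §1.2; folklore] -/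
theorem stub_analyticPieceResolves :
    (∀ (f : ℝ → ℝ) (a δ : ℝ), 0 < δ → ContinuousOn f (Set.Ioo a (a + δ)) → (∃ P : MvPolynomial (Fin 2) ℝ, P ≠ 0 ∧ ∀ s ∈ Set.Ioo a (a + δ), MvPolynomial.eval ![s, f s] P = 0) → ∃ (e : ℕ) (r : ℝ), 0 < e ∧ 0 < r ∧ r ^ e ≤ δ ∧ ((∀ t ∈ Set.Ioo (0:ℝ) r, f (a + t ^ e) = 0) ∨ ∃ (m : ℤ) (G : ℝ → ℝ), AnalyticOnNhd ℝ G (Set.Ioo (-r) r) ∧ G 0 ≠ 0 ∧ ∀ t ∈ Set.Ioo (0:ℝ) r, f (a + t ^ e) = t ^ m * G t)) → (∀ (g : ℝ → ℝ) (e : ℕ) (r : ℝ), 0 < e → 0 < r → (∀ s ∈ Set.Ioc (0:ℝ) 1, AnalyticAt ℝ g s) → MeasureTheory.IntegrableOn g (Set.Ioo (0:ℝ) 1) → ((∀ t ∈ Set.Ioo (0:ℝ) r, g (t ^ e) = 0) ∨ ∃ (m : ℤ) (G : ℝ → ℝ), AnalyticOnNhd ℝ G (Set.Ioo (-r) r)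 ∧ G 0 ≠ 0 ∧ ∀ t ∈ Set.Ioo (0:ℝ) r, g (t ^ e) = t ^ m * G t) → ∃ H : ℝ → ℝ, AnalyticOnNhd ℝ H (Set.Icc (0:ℝ) 1) ∧ ∀ t ∈ Set.Ioo (0:ℝ) 1, H t = g (t ^ e) * ((e : ℝ) * t ^ (e - 1))) → (∀ (u : IntegralRep 1) (e : ℕ) (H : ℝ → ℝ), 0 < e → u.domain = {x : Fin 1 → ℝ | x 0 ∈ Set.Ioo (0:ℝ) 1} → AnalyticOnNhd ℝ H (Set.Icc (0:ℝ) 1) → (∀ t ∈ Set.Ioo (0:ℝ) 1, H t = u.integrand (fun _ => t ^ e) * ((e : ℝ) * t ^ (e - 1))) → ∃ c : FormalRep, c ∈ cubicalSpan ∧ of u - c ∈ relations) → ∀ (u : IntegralRep 1), u.domain = {x : Fin 1 → ℝ | x 0 ∈ Set.Ioo (0:ℝ) 1} → (∀ s ∈ Set.Ioo (0:ℝ) 1, AnalyticAt ℝ (fun s : ℝ => u.integrand (fun _ => s)) s) → ∃ c : FormalRep, c ∈ cubicalSpan ∧ of u - c ∈ relations := by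
  intro hR1 hR3 hR4 u hu han
  -- a piece on `(0,1)` whose integrand is analytic on `(0, 1]` resolves (R1, R3, R4)
  have key : ∀ v : IntegralRep 1, v.domain = {x : Fin 1 → ℝ | x 0 ∈ Set.Ioo (0:ℝ) 1} →
      (∀ s ∈ Set.Ioc (0:ℝ) 1, AnalyticAt ℝ (fun s : ℝ => v.integrand (fun _ => s)) s) →
      ∃ c : FormalRep, c ∈ cubicalSpan ∧ of v - c ∈ relations := by
    intro v hvd hva
    obtain ⟨g, hg⟩ : ∃ g : ℝ → ℝ, g = fun s : ℝ => v.integrand (fun _ => s) := ⟨_, rfl⟩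
    have hga : ∀ s ∈ Set.Ioc (0:ℝ) 1, AnalyticAt ℝ g s := by
      rw [hg]
      exact hva
    have hgc : ContinuousOn g (Set.Ioo (0:ℝ) (0 + 1)) := by
      rw [zero_add]
      exact fun s hs => (hga s (Ioo_subset_Ioc_self hs)).continuousAt.continuousWithinAt
    have hgP : ∃ P : MvPolynomial (Fin 2) ℝ, P ≠ 0 ∧
        ∀ s ∈ Set.Ioo (0:ℝ) (0 + 1), MvPolynomial.eval ![s, g s] P = 0 := by
      rw [zero_add, hg]
      exact apiece_exists_mvPolynomial v hvd
    have hgi : IntegrableOn g (Set.Ioo (0:ℝ) 1) := by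
      rw [hg]
      exact apiece_integrableOn_line v hvd
    obtain ⟨e, r, he, hr, -, hdisj⟩ := hR1 g 0 1 one_pos hgc hgP
    simp only [zero_add] at hdisj
    obtain ⟨H, hH, hHt⟩ := hR3 g e r he hr hga hgi hdisj
    exact hR4 v e H he hvd hH fun t ht => by rw [hHt t ht, hg]
  -- split at `½` and rescale the two halves onto `(0, 1)`
  obtain ⟨u₁, u₂, hu₁d, hu₁i, hu₂d, hu₂i, hsplit⟩ := apiece_split u hu
  obtain ⟨v₁, hv₁d, hv₁i, hv₁⟩ := apiece_exists_affine u₁ 0 2⁻¹ (a := 0) (b := 2⁻¹)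
    (by norm_num) (by norm_num) (by norm_num) BallPeeling.isSemialgebraic_posIoo fun y => by
      rw [hu₁d]
      simp only [mem_setOf_eq, mem_Ioo, sub_zero, div_inv_eq_mul]
      constructor <;> rintro ⟨h1, h2⟩ <;> constructor <;> linarith
  obtain ⟨v₂, hv₂d, hv₂i, hv₂⟩ := apiece_exists_affine u₂ 1 (-2⁻¹) (a := 1) (b := -2⁻¹)
    (by norm_num) (by norm_num) (by norm_num) BallPeeling.isSemialgebraic_posIoo fun y => by
      rw [hu₂d]
      simp only [mem_setOf_eq, mem_Ioo, div_neg, div_inv_eq_mul]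
      constructor <;> rintro ⟨h1, h2⟩ <;> constructor <;> linarith
  -- the rescaled integrands are analytic on `(0, 1]`
  obtain ⟨c₁, hc₁, hvc₁⟩ := key v₁ hv₁d fun s hs => by
    rw [hv₁i, hu₁i]
    dsimp only
    have hmem : (0 : ℝ) + 2⁻¹ * s ∈ Set.Ioo (0:ℝ) 1 := ⟨by linarith [hs.1], by linarith [hs.2]⟩
    have hlin : AnalyticAt ℝ (fun y : ℝ => (0 : ℝ) + 2⁻¹ * y) s := by fun_prop
    exact (AnalyticAt.fun_comp (f := fun y : ℝ => (0 : ℝ) + 2⁻¹ * y) (x := s) (han _ hmem)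
      hlin).fun_mul analyticAt_const
  obtain ⟨c₂, hc₂, hvc₂⟩ := key v₂ hv₂d fun s hs => by
    rw [hv₂i, hu₂i]
    dsimp only
    have hmem : (1 : ℝ) + -2⁻¹ * s ∈ Set.Ioo (0:ℝ) 1 := ⟨by linarith [hs.2], by linarith [hs.1]⟩
    have hlin : AnalyticAt ℝ (fun y : ℝ => (1 : ℝ) + -2⁻¹ * y) s := by fun_prop
    exact (AnalyticAt.fun_comp (f := fun y : ℝ => (1 : ℝ) + -2⁻¹ * y) (x := s) (han _ hmem)
      hlin).fun_mul analyticAt_const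
  refine ⟨c₁ + c₂, cubicalSpan.add_mem hc₁ hc₂, ?_⟩
  have : of u - (c₁ + c₂) = (of u - of u₁ - of u₂) - (of v₁ - of u₁) - (of v₂ - of u₂) +
      (of v₁ - c₁) + (of v₂ - c₂) := by
    abel
  rw [this]
  exact relations.add_mem (relations.add_mem (relations.sub_mem (relations.sub_mem hsplit hv₁)
    hv₂) hvc₁) hvc₂

end Summit.KontsevichZagierPeriods.FurushoPentagon.SectorToKernel
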